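import Summits.BirchSwinnertonDyer.BirchSwinnertonDyer.Theorems.UniversalToricDescentRoadFFMemberSaturation
import Summits.BirchSwinnertonDyer.BirchSwinnertonDyer.Theorems.UniversalToricDescentRoadFFPerLevelDescentTwin
import HarnessLib

/-!
# Route `UniversalToricDescent`, ♭B column (♭B′ `TwinWanFrameAtThreeMultTresT` 27401), line `membertower`:
# at the 3-multiplicative twin, a member tower with a UNIT congruence and ANY exponents gives ♭B′'s Wan clause —
# the growth clause `∀ n ∃ m, e_m + n ≤ m` of the per-level tower (p625405) is DISCHARGED by `p`-saturation

Cell `bsd-wall` (run/shared/lean/pub/bsd-wall/), seat `bsd-wall-utd-p2` (lead prover g13, 2026-08-28);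
`--supports stmt-BirchSwinnertonDyer-27401 --as helper`; Theses-free.

`twin_exists_forall_C_pow_mul_mem_span_of_unitCongMemberTower_of_isTorsion`: under the binders of ♭B′ plus (dec),
`μ(L) = 0` and Λ-torsion of `X^∅_ac(W′)`, a Hida member tower giving — per member, in every `3`-torsion-free
receptacle — SOME `L_m` with a UNIT congruence `L_m ≡ u·L·P_Σ (mod 3^m)` and, under torsion of `X^Σ_ac(A_{g_m})`,
`(3^e)·Ch ⊆ (L_m)` for SOME `e` (no growth condition) yields `∃ k, C(3^k)·Ch_Λ(X^∅)·R₀⟦T⟧ ⊆ (L)`: write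
`P_Σ = 3^t·P′`, `L·P′ = X^s·V + 3·Q` (`…RoadFFMemberSaturation`), improve every member's exponent to `t` at the
universal receptacle and push forward (`receptacle_clause_of_unitCong`), take `L_m := 3^m` at the levels `m ≤ t`,
and feed p625405's per-level kernel with the CONSTANT exponent `t`. HONEST FRAMING: theorems only; CONDITIONAL on
Shapiro (PUBLISHED), the unit-congruence member tower (RESEARCH, port-shaped: per-member weight-`k` rational
anticyclotomic Greenberg-side inclusion at `p = 3` + the two-variable BDP measure congruence), torsion and (dec);
nothing booked; BSD is proved for no curve. References: [Skinner2016PacificMC] §3.1; [Castella2020JIMJ] Def. 1.3,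
Thm. 1.4; [Hsieh2014] Thm. B.
-/

set_option autoImplicit false

noncomputable section

open scoped TensorProduct Classical

open PowerSeries Literature.NumberTheory.EllipticCurves Summit.BirchSwinnertonDyer.Rank1Residual.X2
  Summit.BirchSwinnertonDyer.Rank1Residual.X11b.Halves

namespace Summit.BirchSwinnertonDyer.Rank1Residual.X11b.RoadFFSaturation

/-! ### §4 At the 3-multiplicative twin: a unit-congruence member tower with ANY exponents ⟹ ♭B′'s Wan clause -/

section Twin

open NumberField IsDedekindDomain Field WeierstrassCurve
  Literature.NumberTheory.GaloisRepresentations Literature.NumberTheory.EllipticCurves.BigGaloisRep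
  Literature.NumberTheory.EllipticCurves.GreenbergSelmer Literature.NumberTheory.EllipticCurves.Skinner2016
  Literature.NumberTheory.EllipticCurves.Rank1Residual Literature.NumberTheory.EllipticCurves.Rank1Residual.Typed
  Literature.NumberTheory.EllipticCurves.ModularForms
  Summit.BirchSwinnertonDyer.Rank1Residual.X11b.AcSelmer

set_option maxHeartbeats 800000 in
/-- **UNIT-CONGRUENCE MEMBER TOWER (ANY EXPONENTS) + TORSION + `μ(L) = 0` ⟹ THE RATIONAL WAN CLAUSE AT THE GIVEN
FRAME (♭B′'s consequent).** Under the binders of ♭B′ / line `membertower` plus (dec) `W′(ℚ₃)[3] = 0`: let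
`L ∈ R₀⟦T⟧` have a unit coefficient (`μ(L) = 0`; at a BDP frame of `f_{W′}` this is Hsieh 2014 Thm. B by name), and
suppose that for every level `m ≥ 1` some Hida member `g_m` of `f_{W′}` has, in every `3`-TORSION-FREE receptacle
`(S₀, a, b)`, SOME `L_m ∈ S₀⟦T⟧` with (K2′) a UNIT congruence `L_m ≡ u·L·P_Σ (mod 3^m)` and (K1) under torsion of
`X^Σ_ac(A_{g_m})` a one-sided inclusion `(3^e)·Ch(X^Σ_ac(A_{g_m}))·S₀⟦T⟧ ⊆ (L_m)` for SOME exponent `e` (no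
growth condition, `e` may depend on everything). THEN, if `X^∅_ac(W′/K_∞; slot 𝔭′)` is Λ-torsion, some `k` has
`C(3^k)·G ∈ (L)` for every `G ∈ Ch_Λ(X^∅)·R₀⟦T⟧`. Proof: write `P_Σ = 3^t·P′` with `3 ∤ P′` in `R₀⟦T⟧`
(`exists_eq_C_pow_mul_of_ne_zero`); `L·P′ = X^s·V + 3·Q` with `V` a unit (`exists_shape_of_isUnit_coeff`); at each
level `m > t` instantiate the tower at the universal receptacle `R₀ ⊗_{ℤ₃} 𝒪_m` (`3`-torsion-free), improve the
exponent to `t` by `p`-saturation (`span_pow_mul_le_of_unitCong`), and push forward to every receptacle along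
`Algebra.TensorProduct.lift` (`exists_ringHom_receptacle`); at levels `m ≤ t` take `L_m := 3^m`. This is the
per-level member tower of p625405 with the CONSTANT exponent `t`, and
`twin_exists_forall_C_pow_mul_mem_span_of_perLevelMemberTower_of_isTorsion` concludes. CONDITIONAL on Shapiro
`hSh` (PUBLISHED), the unit-congruence member tower (RESEARCH, port-shaped), torsion and (dec); nothing is booked;
BSD is proved for no curve. [cite: Skinner2016PacificMC, §3.1 (p. 192)] [cite: Castella2020JIMJ, Def. 1.3, Thm. 1.4
(the members' measures are specialisations of one two-variable measure)] [cite: Hsieh2014, Thm. B] -/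
theorem twin_exists_forall_C_pow_mul_mem_span_of_unitCongMemberTower_of_isTorsion
    (hSh : SkinnerUrban2014.prop323_XAc_equiv_XBigDecomp)
    (W' : WeierstrassCurve ℚ) [W'.IsElliptic] [W'.IsGloballyMinimal] (N' : ℕ)
    (K : Type) [Field K] [NumberField K]
    (hm : Mult W' 3) (hsurj : W'.HasSurjectiveModNGaloisRep 3) (hN : W'.conductorNorm ℤ = N')
    (hK : IsImaginaryQuadratic K) (hH : SatisfiesHeegnerHypothesis N' K)
    (κ : ZpExtension K 3) (hκ : κ.IsAnticyclotomic) (γ : Field.absoluteGaloisGroup K) [Fact (κ.IsTopGenerator γ)]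
    (𝔭' : HeightOneSpectrum (𝓞 K)) (h𝔭' : ((3 : ℕ) : 𝓞 K) ∈ 𝔭'.asIdeal)
    (hiv : ∀ Q : (W'.baseChange ℚ_[3]).toAffine.Point, 3 • Q = 0 → Q = 0)
    (hT₀ : Module.IsTorsion (IwasawaAlgebra 3) (AcSelmer.XAc (W'.baseChange K) 3 κ 𝔭' ∅ γ))
    (L : UnrSeries 3) (hμL : ∃ i : ℕ, IsUnit (PowerSeries.coeff i L))
    (hmem : ∀ m : ℕ, 1 ≤ m →
      ∃ D : Skinner2016.HidaCongruentMember W' 3 m,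
        ∀ [TopologicalSpace (PowerSeries (padicCoeffIntegers D.ι))]
          [ContinuousSMul (PowerSeries (padicCoeffIntegers D.ι))
            (BigRepModule (padicCoeffIntegers D.ι) 3 (Cofree D.Δ.ρ (padicCoeffField D.ι)))],
        ∀ (S₀ : Type) [CommRing S₀] (a : unrIntegers 3 →+* S₀) (b : padicCoeffIntegers D.ι →+* S₀)
          (j : ℤ_[3] →+* unrIntegers 3),
          (∀ x : ℤ_[3], ((j x : unrIntegers 3) : ℂ_[3]) = algebraMap ℚ_[3] ℂ_[3] (x : ℚ_[3])) →
          a.comp j = b.comp (algebraMap ℤ_[3] (padicCoeffIntegers D.ι)) →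
          (∀ x : S₀, ((3 : ℕ) : S₀) * x = 0 → x = 0) →
          ∃ Lm u : PowerSeries S₀, IsUnit u ∧
            Lm - u * PowerSeries.map a (L * PowerSeries.map j (W'.sigmaEulerElement 3 K κ)) ∈
              Ideal.span {((3 : ℕ) : PowerSeries S₀) ^ m} ∧
            (Module.IsTorsion (PowerSeries (padicCoeffIntegers D.ι))
                (XBig κ (D.Δ.cofreeRepOver K) 𝔭' (↑(W'.sigmaPlacesFinset 3 K))) →
              ∃ e : ℕ, Ideal.span {((3 : ℕ) : PowerSeries S₀) ^ e} *
                  (XBig.charIdeal κ (D.Δ.cofreeRepOver K) 𝔭' (↑(W'.sigmaPlacesFinset 3 K))).map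
                    (PowerSeries.map b) ≤ Ideal.span {Lm})) :
    ∃ k : ℕ, ∀ G ∈ (AcSelmer.XAc.charIdeal (W'.baseChange K) 3 κ 𝔭' ∅ γ).map (PowerSeries.map (toUnr 3)),
      PowerSeries.C (((3 : ℕ) : unrIntegers 3) ^ k) * G ∈ Ideal.span {L} := by
  -- ### the finite-`μ` split `P_Σ = 3^t·P′` and the shape `L·P′ = X^s·V + 3·Q`
  have hPS0 : PowerSeries.map (toUnr 3) (W'.sigmaEulerElement 3 K κ) ≠ 0 := fun h ↦
    W'.sigmaEulerElement_ne_zero 3 K κ (map_toUnr_injective (by rw [h, map_zero]))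
  obtain ⟨t, P', hP'u, hfac⟩ := exists_eq_C_pow_mul_of_ne_zero hPS0
  obtain ⟨s, V, Q, hV, hshape⟩ := exists_shape_of_isUnit_coeff (exists_isUnit_coeff_mul hμL hP'u)
  have hM : L * PowerSeries.map (toUnr 3) (W'.sigmaEulerElement 3 K κ) =
      C ((3 : ℕ) : unrIntegers 3) ^ t * (L * P') := by
    rw [hfac]; ring
  -- ### `NeZero (N′/3)` for the member API
  have hpN : 3 ∣ W'.conductorNorm ℤ := dvd_conductorNorm_of_mult hm
  have hN0 : W'.conductorNorm ℤ ≠ 0 := (W'.conductorNorm_pos_holds).ne'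
  haveI : NeZero (W'.conductorNorm ℤ / 3) :=
    ⟨(Nat.div_pos (Nat.le_of_dvd (Nat.pos_of_ne_zero hN0) hpN) (by norm_num)).ne'⟩
  letI : Algebra ℤ_[3] (unrIntegers 3) := (toUnr 3).toAlgebra
  have hjalg : algebraMap ℤ_[3] (unrIntegers 3) = toUnr 3 := rfl
  -- ### feed the per-level kernel p625405 with the CONSTANT exponent `t`
  refine twin_exists_forall_C_pow_mul_mem_span_of_perLevelMemberTower_of_isTorsion hSh W' N' K hm hsurj hN hK
    hH κ hκ γ 𝔭' h𝔭' hiv hT₀ L hμL (fun _ ↦ t) (fun n ↦ ⟨t + n + 1, by omega, by omega⟩) ?_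
  intro m hm1
  -- term mode on purpose (`obtain ⟨D, _⟩` in this goal hits the whnf heartbeat ceiling)
  exact (hmem m hm1).elim fun D hD ↦ ⟨D, fun S₀ _ a b j hj hab ↦ by
    -- `j = toUnr 3` (both lift `ℤ₃ → ℚ₃ → ℂ₃` into the subring `R₀`)
    have hj' : j = toUnr 3 := RingHom.ext fun x ↦ Subtype.ext ((hj x).trans (coe_toUnr 3 x).symm)
    subst hj'
    rcases Nat.lt_or_ge t m with htm | hmt
    · -- `t < m`: universal receptacle + saturation + push-forward
      haveI : Module.Free ℤ_[3] (padicCoeffIntegers D.ι) := D.moduleFree_coeffRing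
      exact receptacle_clause_of_unitCong 3 (padicCoeffIntegers D.ι) hjalg _ _ _ (L * P') V Q t s m hV hM hshape
        htm (fun S₁ _ a₁ b₁ hab₁ hreg₁ ↦ hD S₁ a₁ b₁ (toUnr 3) (coe_toUnr 3) hab₁ hreg₁) S₀ a b hab
    · -- `m ≤ t`: `L_m := 3^m` works trivially
      exact ⟨((3 : ℕ) : PowerSeries S₀) ^ m,
        fun _ ↦ Ideal.mul_le_right.trans (Ideal.span_singleton_le_span_singleton.mpr (pow_dvd_pow _ hmt)),
        le_sup_right⟩⟩

end Twin

end Summit.BirchSwinnertonDyer.Rank1Residual.X11b.RoadFFSaturation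

end
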